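import Mathlib.CategoryTheory.Comma.Over.Basic
import Mathlib.CategoryTheory.Equivalence
import Mathlib.GroupTheory.OrderOfElement
import Mathlib.LinearAlgebra.TensorProduct.Basic
import Mathlib.Analysis.Complex.Circle
import Mathlib.Topology.Sober
import Literature.AlgebraicGeometry.Frobenioids.PreFrobenioidMorphisms
import Literature.AlgebraicGeometry.Frobenioids.CategoriesFactorization
import Literature.AlgebraicGeometry.Frobenioids.Dissection
import Literature.AlgebraicGeometry.Frobenioids.TopologicalRepresentation
import Literature.AlgebraicGeometry.Frobenioids.PerfFactorial
import Literature.AlgebraicGeometry.Frobenioids.FiniteEtaleBase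
import HarnessLib

/-!
# Frobenioids II, Theorem 3.6 (Basic Properties of Archimedean, Angular Frobenioids) and
# Remark 3.6.1 — the statements, generically over the pre-Frobenioid they speak about

Mochizuki, *The geometry of Frobenioids II: poly-Frobenioids*, Kyushu J. Math. **62** (2008)
401–460, §3 "Archimedean Primes", Theorem 3.6 (i)–(x) pp. 36–38 and Remark 3.6.1 p. 39 (author's
kurims text) [cite: MochizukiFrdII2008, Thm 3.6 pp.36-38].

> **Theorem 3.6.** In the notation and terminology of Example 3.3, let `F` be one of the following
> Frobenioids: `C^Λ`, `A` [where, when `F = A`, we take `Λ = ℤ`]. Also, denote by `Φ^∡` the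
> restriction `Φ^∡₀|_D` to `D` of the functor `Φ^∡₀ : D₀ → Mon` determined by the assignment
> `Spec(K) ↦ O_K^×` and by `Φ^fld` the functor `D → Mon` given by `D ↦ Φ^gp(D) × Φ^∡(D)` […].
> Then: (i) … (x) [quoted item by item below].

**How the statements are typed (statements-first; nothing is asserted).** Every item is a property of
ONE of the categories of Example 3.3 — `C^Λ` (`Λ ∈ {ℤ, ℚ, ℝ}`) or the angular Frobenioid `A` — each a
category `X` with a pre-Frobenioid structure `F : X → F_Φ` ([FrdI] Def. 1.1 (iv)) over a base `D` with
`G : D → D₀ = ArchBase` ([FrdII] §3 p. 23; `FiniteEtaleBase.lean`, which carries Def. 3.1 (v): `RC.*`).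
Those categories are built by the ONE WRITER of Example 3.3 (seat abc-iut-L1-t6). Each item is typed
here as a named `Prop`-valued PREDICATE of the data it speaks about — `(G, F, Λ)` plus, where an item
uses more of the construction, that structure as an explicit parameter (boundaries `∂A_A` in (vii),
radial endomorphisms in (iii), the model Frobenioid in the "model type" clauses) — in the typology of
[FrdI] Def. 1.2 (`PreFrobenioidMorphisms.lean`) and [FrdI]/[FrdII] §0. The clauses in the vocabulary of
[FrdI] §2–§4 (characteristic splitting, (rationally) standard type) are in `ArchimedeanStandardType.lean`.

**Schema label (layer ruling W2-8 (5) / P1).** Every predicate below binds its SUBJECT — the structure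
functor `F` (and `Λ`) — as a free parameter; the printed claims are exactly the closed instantiations
`F := (ArchFrd.archFrobenioid π pf rlf Λ).str` (for `C^Λ`) and `F := ArchFrd.A.toElem π` (for `A`) made in
`ArchimedeanTheoremsInstances.lean`, and NO OTHER binding is a statement of the paper (e.g.
`Thm36i_istr_all F Λ` at `F :=` the structure of `C^ℤ` and `Λ := ℚ` is simply false). Consumers cite the
instances, never these schemas at a binding of their own.

**Dictionary.** `(C^Λ)^istr` / `A^istr` = the full subcategory of isotropic objects with the
restricted structure functor (`istr F` below; [FrdI] Def. 1.2 (iv), Prop. 1.9 (v));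
`F^imtr-pre_A` = the full subcategory of `F_A = Over A` on the isometric pre-steps (`ImtrPreOver`;
[FrdI] Prop. 1.9 — equivalent to the slice of the wide subcategory `ImtrPreCat` of the Prop. 1.9
file by "isometric pre-steps are closed under left cancellation", Prop. 1.9 (i)); the "natural
action of `Aut_F(A)` on `O^▷(A), O^×(A)`" is conjugation inside `End A` / `Aut A`; `S¹` is
Mathlib's `Circle`, `S¹ ⊗_ℤ ℚ` is `TensorProduct ℤ (Additive Circle) ℚ`.

**Flag register L1 #6 (referee ref-a A8-F3, 2026-08-25).** Item (iv), second sentence, typed as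
"automorphisms acting identically on `O^▷(A)` and on `O^×(A)` have the same image in `Aut_{D₀}(A₀)`", is
FALSE AS PRINTED for `Λ = ℤ` at complex non-isotropic objects of the model (there `O^×(A) = {1}` by
(v)(a) and `O^▷(A)` is radial, fixed by an automorphism over complex conjugation; kernel witness
`ArchFrd.C0.not_thm36iv_faithful_C0` in `ArchimedeanAutActionWitness.lean`); `Λ = ℚ`: no failure;
probable intent: the isotropic-hull reading. The printed sentence is kept as the schema
`Thm36iv_faithful` (labelled, never to be bound as a hypothesis) next to the two repaired readings
`Thm36iv_faithful_of_isIsotropic` (proved on `C₀` in the witness file) and `Thm36iv_faithful_istr`.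
No statement of the paper is strengthened; typed ≠ proved.
-/

namespace Literature.AlgebraicGeometry.Frobenioids

open CategoryTheory

universe w v v' v₂ v₃ v₄ u u' u₂ u₃ u₄

namespace ArchFrd

open scoped TensorProduct

variable {D : Type u} [Category.{v} D] (G : D ⥤ ArchBase)
  {Φ : Dᵒᵖ ⥤ CommMonCat.{w}} {X : Type u'} [Category.{v'} X] (F : X ⥤ ElemFrobenioid Φ)
  (Λ : MonoidType)

/-! ### Generic vocabulary used by the statements -/

/-- `F^istr → F_Φ`: the pre-Frobenioid structure of `F` restricted to the full subcategory `F^istr` of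
isotropic objects ([FrdI] Def. 1.2 (iv) `C^istr`; the Frobenioid `C^istr` of [FrdI] Prop. 1.9 (v)).
[cite: MochizukiFrdI2008, Def. 1.2 (iv) p.23] -/
abbrev istr : (PreFrobenioid.isotropicObjects F).FullSubcategory ⥤ ElemFrobenioid Φ :=
  (PreFrobenioid.isotropicObjects F).ι ⋙ F

/-- `F^imtr-pre_A`: the category of isometric pre-steps `B → A` over `A` ([FrdI] Prop. 1.9:
"`C^imtr-pre ⊆ C` the subcategory determined by the isometric pre-steps, `C^imtr-pre_A := (C^imtr-pre)_A`"),
as the full subcategory of `F_A = Over A` on the isometric pre-steps. [cite: MochizukiFrdI2008, Prop. 1.9 p.31] -/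
abbrev ImtrPreOver (A : X) : Type (max u' v') :=
  ObjectProperty.FullSubcategory fun f : Over A =>
    PreFrobenioid.IsIsometry F f.hom ∧ PreFrobenioid.IsPreStep F f.hom

section CFPLift

variable {C₁ : Type u₂} [Category.{v₂} C₁] {C₂ : Type u₃} [Category.{v₃} C₂]
  {D' : Type u₄} [Category.{v₄} D'] {E : Type u'} [Category.{v'} E]

/-- The functor into a categorical fiber product `C₁ ×_D C₂` ([FrdI] §0, `CFP`) determined by functors
`K₁ : E → C₁`, `K₂ : E → C₂` and an isomorphism `Φ₁ ∘ K₁ ≅ Φ₂ ∘ K₂` (used to phrase "determines an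
equivalence of categories `C ⥲ A ×_{A^istr} C^istr`", Thm. 3.6 (iii)). [cite: MochizukiFrdI2008, §0 p.17] -/
def toCFP (Φ₁ : C₁ ⥤ D') (Φ₂ : C₂ ⥤ D') (K₁ : E ⥤ C₁) (K₂ : E ⥤ C₂)
    (e : K₁ ⋙ Φ₁ ≅ K₂ ⋙ Φ₂) : E ⥤ CFP Φ₁ Φ₂ where
  obj A := ⟨K₁.obj A, K₂.obj A, e.app A⟩
  map f := ⟨K₁.map f, K₂.map f, e.hom.naturality f⟩
  map_id A := by ext <;> simp
  map_comp f g := by ext <;> simp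

end CFPLift

/-! ### Theorem 3.6 (i): the archimedean Frobenioids `C^Λ` -/

/-- **Theorem 3.6 (i)**, first clauses (FrdII p. 36), for `F = C^Λ → F_Φ`: "The Frobenioid `(C^Λ)^istr`
is of isotropic, base-trivial […] type" ([FrdI] Def. 1.2 (iv)/(v) for the restricted structure
`istr F`). [cite: MochizukiFrdII2008, Thm 3.6 (i) p.36] -/
def Thm36i_istrTypes : Prop :=
  PreFrobenioid.IsOfIsotropicType (istr F) ∧
    PreFrobenioid.IsOfType (PreFrobenioid.IsBaseTrivial (istr F))

/-- **Theorem 3.6 (i)**, "model type" clause (FrdII p. 36), for `F = C^Λ`: "`(C^Λ)^istr` is of […] model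
type, with rational function monoid naturally isomorphic to `(Φ^fld)^Λ`" — typed as: `(C^Λ)^istr` is
equivalent, compatibly with the structure functors to `F_Φ`, to the model Frobenioid `M` ([FrdI]
Thm. 5.2) of the datum `(Φ^fld)^Λ → (Φ^Λ)^gp`; the model Frobenioid and its structure functor
`FM : M → F_Φ` are the parameters (instantiated with `ModelFrobenioid` in the instances file).
[cite: MochizukiFrdII2008, Thm 3.6 (i) p.36] -/
def Thm36i_istrModel {M : Type u₂} [Category.{v₂} M] (FM : M ⥤ ElemFrobenioid Φ) : Prop :=
  ∃ e : (PreFrobenioid.isotropicObjects F).FullSubcategory ≌ M, Nonempty (e.functor ⋙ FM ≅ istr F)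

/-- **Theorem 3.6 (i)** (FrdII p. 36), for `F = C^Λ`: "If `Λ ≥ ℚ`, then `(C^Λ)^istr = C^Λ`", i.e. for
`Λ ∈ {ℚ, ℝ}` every object of `C^Λ` is isotropic. [cite: MochizukiFrdII2008, Thm 3.6 (i) p.36] -/
def Thm36i_istr_all : Prop := Λ ≠ .Z → PreFrobenioid.IsOfIsotropicType F

/-- **Theorem 3.6 (i)** (FrdII p. 36), for `F = C^Λ`: "For arbitrary `Λ`, there is a natural equivalence
of categories `(C^Λ)^un-tr ⥲ C^ℝ`, compatible with the Frobenioid structures" — over the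
unit-trivialisation `(C^Λ)^un-tr → F_Φ` ([FrdI] Def. 3.1, seat abc-iut-L1-t3) and `C^ℝ → F_Φ` as
parameters `FU`, `FR`. [cite: MochizukiFrdII2008, Thm 3.6 (i) p.36] -/
def Thm36i_untrEquiv {U : Type u₂} [Category.{v₂} U] {R : Type u₃} [Category.{v₃} R]
    (FU : U ⥤ ElemFrobenioid Φ) (FR : R ⥤ ElemFrobenioid Φ) : Prop :=
  ∃ e : U ≌ R, Nonempty (e.functor ⋙ FR ≅ FU)

/-- **Theorem 3.6 (i)**, typology clauses (FrdII p. 36), for `F = C^Λ`: "the Frobenioid `C^Λ` is of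
`Aut`-ample, `Aut^sub`-ample, `End`-ample, and metrically trivial type, but not of group-like type"
([FrdI] Def. 1.2 (iv)/(v)). [cite: MochizukiFrdII2008, Thm 3.6 (i) p.36] -/
def Thm36i_ampleTypes : Prop :=
  PreFrobenioid.IsOfType (PreFrobenioid.IsAutAmple F) ∧
    PreFrobenioid.IsOfType (PreFrobenioid.IsAutSubAmple F) ∧
    PreFrobenioid.IsOfType (PreFrobenioid.IsEndAmple F) ∧
    PreFrobenioid.IsOfType (PreFrobenioid.IsMetricallyTrivial F) ∧
    ¬ PreFrobenioid.IsOfType (PreFrobenioid.IsGroupLikeObj F)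

/-! ### Theorem 3.6 (ii): the angular Frobenioid `A` -/

/-- **Theorem 3.6 (ii)**, first clause (FrdII p. 37), for `F = A → F_Φ` the angular Frobenioid: "The
Frobenioid `A^istr` is of base-trivial […] type". [cite: MochizukiFrdII2008, Thm 3.6 (ii) p.37] -/
def Thm36ii_istrBaseTrivial : Prop :=
  PreFrobenioid.IsOfType (PreFrobenioid.IsBaseTrivial (istr F))

/-- **Theorem 3.6 (ii)**, "model type" clause (FrdII p. 37), for `F = A`: "`A^istr` is of […] model type,
with rational function monoid naturally isomorphic to `Φ^∡`" — typed as an equivalence over `F_Φ`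
with the model Frobenioid `M` of the datum `Φ^∡ → Φ^gp` (parameter `FM : M → F_Φ`, cf. (i)).
[cite: MochizukiFrdII2008, Thm 3.6 (ii) p.37] -/
def Thm36ii_istrModel {M : Type u₂} [Category.{v₂} M] (FM : M ⥤ ElemFrobenioid Φ) : Prop :=
  Thm36i_istrModel F FM

/-- **Theorem 3.6 (ii)**, typology clauses (FrdII p. 37), for `F = A`: "The Frobenioid `A` is of
`Aut`-ample, `Aut^sub`-ample, `End`-ample, group-like, and metrically trivial type".
[cite: MochizukiFrdII2008, Thm 3.6 (ii) p.37] -/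
def Thm36ii_ampleTypes : Prop :=
  PreFrobenioid.IsOfType (PreFrobenioid.IsAutAmple F) ∧
    PreFrobenioid.IsOfType (PreFrobenioid.IsAutSubAmple F) ∧
    PreFrobenioid.IsOfType (PreFrobenioid.IsEndAmple F) ∧
    PreFrobenioid.IsOfType (PreFrobenioid.IsGroupLikeObj F) ∧
    PreFrobenioid.IsOfType (PreFrobenioid.IsMetricallyTrivial F)

/-! ### Theorem 3.6 (iii): the isometrization functor -/

/-- **Theorem 3.6 (iii)**, factorization (FrdII p. 37), for `F = C → F_Φ`: "Every morphism `φ : B → A`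
of `C` factors uniquely as a composite `φ = β ∘ α`, where `α` is an isometry [hence belongs to `A`],
and `β ∈ O^▷(A) ⊆ Φ^fld(A)` belongs to the submonoid `Φ^gp(A) × {1} ⊆ Φ^fld(A)` [cf. the
characteristic splitting of (i)]" — the predicates `radial A` on `End(A)` ("the elements of `O^▷(A)`
with trivial `Φ^∡`-component", i.e. the submonoid `Φ^gp(A) × {1}` of the characteristic splitting of
(i)) are the parameter. [cite: MochizukiFrdII2008, Thm 3.6 (iii) p.37] -/
def Thm36iii_factorization (radial : ∀ A : X, (A ⟶ A) → Prop) : Prop :=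
  ∀ ⦃B A : X⦄ (φ : B ⟶ A), ∃! p : (B ⟶ A) × (A ⟶ A),
    PreFrobenioid.IsIsometry F p.1 ∧ p.2 ∈ PreFrobenioid.endSubmonoid F A ∧ radial A p.2 ∧
      p.1 ≫ p.2 = φ

/-- **Theorem 3.6 (iii)**, equivalence (FrdII p. 37): "the assignment `φ ↦ α` determines an
'isometrization functor' `C → A` which, together with the isotropification functors `C → C^istr`,
`A → A^istr` [cf. [FrdI], Proposition 1.9, (v)], determines an equivalence of categories
`C ⥲ A ×_{A^istr} C^istr` that is 1-compatible with the natural functors to `F_Φ` on both sides."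
Parameters: the isometrization functors `isom : C → A`, `isomI : C^istr → A^istr`, the
isotropification functors `istrA`, `istrC` ([FrdI] Prop. 1.9 (v), seat abc-iut-L1-t1), the
1-commutativity `isom ∘ istrA ≅ istrC ∘ isomI` making the square a functor to the categorical fiber
product ([FrdI] §0 `CFP`), and the structure functors `F : C → F_Φ`, `FCi : C^istr → F_Φ`; the
natural functor `A ×_{A^istr} C^istr → F_Φ` is read through the projection to `C^istr`.
[cite: MochizukiFrdII2008, Thm 3.6 (iii) p.37] -/
def Thm36iii_equivalence {XA : Type u₂} [Category.{v₂} XA] {XAi : Type u₃} [Category.{v₃} XAi]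
    {Xi : Type u₄} [Category.{v₄} Xi] (isom : X ⥤ XA) (istrA : XA ⥤ XAi) (istrC : X ⥤ Xi)
    (isomI : Xi ⥤ XAi) (e : isom ⋙ istrA ≅ istrC ⋙ isomI) (FCi : Xi ⥤ ElemFrobenioid Φ) : Prop :=
  (toCFP istrA isomI isom istrC e).IsEquivalence ∧
    OneCommutes (toCFP istrA isomI isom istrC e) (CFP.proj₂ istrA isomI ⋙ FCi) (𝟭 X) F

/-! ### Theorem 3.6 (iv): the action of `Aut_F(A)` on `O^▷(A)`, `O^×(A)` -/

/-- **Theorem 3.6 (iv)**, first sentence (FrdII p. 37), for `F ∈ {C^Λ, A}` with `F → D → D₀`: "Let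
`A ∈ Ob(F)`; `A_D := Base(A) ∈ Ob(D)`. Write `A₀ ∈ Ob(D₀)` for the image of `A_D` in `D₀`. Then the
natural action [by conjugation] of `Aut_F(A)` on `O^▷(A), O^×(A)` factors through `Aut_{D₀}(A₀)`":
automorphisms with the same image in `Aut_{D₀}(A₀)` act identically.
[cite: MochizukiFrdII2008, Thm 3.6 (iv) p.37] -/
def Thm36iv_factors : Prop :=
  ∀ (A : X) (α α' : Aut A),
    (PreFrobenioid.baseFunctor F ⋙ G).mapIso α = (PreFrobenioid.baseFunctor F ⋙ G).mapIso α' →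
      (∀ f ∈ PreFrobenioid.endSubmonoid F A, α.inv ≫ f ≫ α.hom = α'.inv ≫ f ≫ α'.hom) ∧
        ∀ u ∈ PreFrobenioid.unitsSubgroup F A, α.symm ≪≫ u ≪≫ α = α'.symm ≪≫ u ≪≫ α'

/-- PRINTED CLAIM UNDER REVIEW (erratum candidate; layer rulings P1 / flag register L1 #6; referee
ref-a A8-F3 2026-08-25: "reading (3) = the printed words, FALSE as printed at `Λ = ℤ` for complex
non-isotropic `A` (forced by (v)(a)); `Λ = ℚ` no failure; probable intent = the isotropic-hull reading") —
kernel witness on the model `C₀`: `ArchFrd.C0.not_thm36iv_faithful_C0` (`ArchimedeanAutActionWitness.lean`).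
DO NOT bind this predicate as a hypothesis; the repaired readings are `Thm36iv_faithful_of_isIsotropic`
(holds on `C₀`, proved there) and `Thm36iv_faithful_istr` (probable intent). The printed text,
**Theorem 3.6 (iv)**, second sentence (FrdII p. 37): "If, moreover, `Λ ∈ {ℤ, ℚ}`, then this
factorization determines a faithful action of the image of `Aut_F(A)` in `Aut_{D₀}(A₀)` on `O^▷(A),
O^×(A)`" — typed as: automorphisms acting identically on `O^▷(A)` and on `O^×(A)` have the same image
in `Aut_{D₀}(A₀)`. [cite: MochizukiFrdII2008, Thm 3.6 (iv) p.37] -/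
def Thm36iv_faithful : Prop :=
  Λ ≠ .R →
    ∀ (A : X) (α α' : Aut A),
      (∀ f ∈ PreFrobenioid.endSubmonoid F A, α.inv ≫ f ≫ α.hom = α'.inv ≫ f ≫ α'.hom) →
        (∀ u ∈ PreFrobenioid.unitsSubgroup F A, α.symm ≪≫ u ≪≫ α = α'.symm ≪≫ u ≪≫ α') →
          (PreFrobenioid.baseFunctor F ⋙ G).mapIso α = (PreFrobenioid.baseFunctor F ⋙ G).mapIso α'

/-- Candidate repaired reading (3) of **Theorem 3.6 (iv)**, second sentence (L1-lead RULING
2026-08-25T19:26:58Z (c); NOT the printed text, recorded for the referee's grading): the same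
faithfulness, asserted only for ISOTROPIC `A`. (On the model of Example 3.3 this holds for isotropic
complex `A`, where `O^×(A) ≅ S¹` and an automorphism over complex conjugation acts by inversion, and
trivially for real `A`; cf. `ArchimedeanAutActionWitness.lean`.) Reading (2) — "faithful" for the action
of `Aut_F(A)` modulo the kernel of the action — is tautological and is recorded here only.
[cite: MochizukiFrdII2008, Thm 3.6 (iv) p.37] -/
def Thm36iv_faithful_of_isIsotropic : Prop :=
  Λ ≠ .R →
    ∀ (A : X), PreFrobenioid.IsIsotropic F A → ∀ (α α' : Aut A),
      (∀ f ∈ PreFrobenioid.endSubmonoid F A, α.inv ≫ f ≫ α.hom = α'.inv ≫ f ≫ α'.hom) →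
        (∀ u ∈ PreFrobenioid.unitsSubgroup F A, α.symm ≪≫ u ≪≫ α = α'.symm ≪≫ u ≪≫ α') →
          (PreFrobenioid.baseFunctor F ⋙ G).mapIso α = (PreFrobenioid.baseFunctor F ⋙ G).mapIso α'

/-- Candidate repaired reading (1) of **Theorem 3.6 (iv)**, second sentence (L1-lead RULING
2026-08-25T19:26:58Z (c); NOT the printed text): the action is read on `O^▷(A^istr)`, `O^×(A^istr)`
through the isotropic hull `h : A → A^istr` ([FrdI] Def. 1.2 (iv), 1.3 (vii)) — automorphisms `α, α'`
of `A` whose induced automorphisms `β, β'` of `A^istr` (`α ∘ h = h ∘ β`-squares) act identically on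
`O^▷(A^istr)` and `O^×(A^istr)` have the same image in `Aut_{D₀}(A₀)`.
[cite: MochizukiFrdII2008, Thm 3.6 (iv) p.37] -/
def Thm36iv_faithful_istr : Prop :=
  Λ ≠ .R →
    ∀ (A B : X) (h : A ⟶ B), PreFrobenioid.IsIsotropicHull F h →
      ∀ (α α' : Aut A) (β β' : Aut B), α.hom ≫ h = h ≫ β.hom → α'.hom ≫ h = h ≫ β'.hom →
        (∀ f ∈ PreFrobenioid.endSubmonoid F B, β.inv ≫ f ≫ β.hom = β'.inv ≫ f ≫ β'.hom) →
          (∀ u ∈ PreFrobenioid.unitsSubgroup F B, β.symm ≪≫ u ≪≫ β = β'.symm ≪≫ u ≪≫ β') →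
            (PreFrobenioid.baseFunctor F ⋙ G).mapIso α = (PreFrobenioid.baseFunctor F ⋙ G).mapIso α'

/-! ### Theorem 3.6 (v): the groups `O^×(A)` -/

/-- **Theorem 3.6 (v)** (FrdII p. 37), for `F ∈ {C^Λ, A}`, `A ∈ Ob(F)`: "the group `O^×(A)` is trivial
if and only if one of the following holds: (a) `Λ = ℤ` and `A` is complex non-isotropic; (b) `Λ = ℚ`
and `A` is real; (c) `Λ = ℝ`." [cite: MochizukiFrdII2008, Thm 3.6 (v) p.37] -/
def Thm36v_trivial : Prop :=
  ∀ A : X, PreFrobenioid.unitsSubgroup F A = ⊥ ↔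
    (Λ = .Z ∧ RC.complexObjects (PreFrobenioid.baseFunctor F ⋙ G) A ∧
        ¬ PreFrobenioid.IsIsotropic F A) ∨
      (Λ = .Q ∧ RC.realObjects (PreFrobenioid.baseFunctor F ⋙ G) A) ∨ Λ = .R

/-- **Theorem 3.6 (v)** (FrdII p. 37): "The group `O^×(A)` is nontrivial and torsion free […] if and
only if `Λ = ℚ` and `A` is complex." [cite: MochizukiFrdII2008, Thm 3.6 (v) p.37] -/
def Thm36v_torsionFree : Prop :=
  ∀ A : X,
    (PreFrobenioid.unitsSubgroup F A ≠ ⊥ ∧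
        ∀ u : PreFrobenioid.unitsSubgroup F A, IsOfFinOrder u → u = 1) ↔
      (Λ = .Q ∧ RC.complexObjects (PreFrobenioid.baseFunctor F ⋙ G) A)

/-- **Theorem 3.6 (v)**, the bracket "[and in fact isomorphic to `S¹ ⊗_ℤ ℚ`]" (FrdII p. 37): for
`Λ = ℚ` and `A` complex, `O^×(A) ≅ S¹ ⊗_ℤ ℚ` as abstract groups.
[cite: MochizukiFrdII2008, Thm 3.6 (v) p.37] -/
def Thm36v_isoCircleTensorRat : Prop :=
  Λ = .Q → ∀ A : X, RC.complexObjects (PreFrobenioid.baseFunctor F ⋙ G) A →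
    Nonempty (Additive (PreFrobenioid.unitsSubgroup F A) ≃+ (Additive Circle ⊗[ℤ] ℚ))

/-- **Theorem 3.6 (v)** (FrdII p. 37): "The group `O^×(A)` is of order two if and only if `Λ = ℤ` and
`A` is real." [cite: MochizukiFrdII2008, Thm 3.6 (v) p.37] -/
def Thm36v_orderTwo : Prop :=
  ∀ A : X, Nat.card (PreFrobenioid.unitsSubgroup F A) = 2 ↔
    (Λ = .Z ∧ RC.realObjects (PreFrobenioid.baseFunctor F ⋙ G) A)

/-- **Theorem 3.6 (v)** (FrdII p. 37): "The group `O^×(A)` has infinitely many torsion elements […] if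
and only if `Λ = ℤ` and `A` is complex isotropic." [cite: MochizukiFrdII2008, Thm 3.6 (v) p.37] -/
def Thm36v_torsion : Prop :=
  ∀ A : X, {u : PreFrobenioid.unitsSubgroup F A | IsOfFinOrder u}.Infinite ↔
    (Λ = .Z ∧ RC.complexObjects (PreFrobenioid.baseFunctor F ⋙ G) A ∧ PreFrobenioid.IsIsotropic F A)

/-- **Theorem 3.6 (v)**, the bracket "[and is in fact isomorphic to `S¹`]" (FrdII p. 37): for `Λ = ℤ`
and `A` complex isotropic, `O^×(A) ≅ S¹` as abstract groups. [cite: MochizukiFrdII2008, Thm 3.6 (v) p.37] -/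
def Thm36v_isoCircle : Prop :=
  Λ = .Z → ∀ A : X, RC.complexObjects (PreFrobenioid.baseFunctor F ⋙ G) A →
    PreFrobenioid.IsIsotropic F A → Nonempty (PreFrobenioid.unitsSubgroup F A ≃* Circle)

/-! ### Theorem 3.6 (vi): pseudo-terminal objects -/

/-- **Theorem 3.6 (vi)** (FrdII p. 37), for `F ∈ {C^Λ, A}` (underlying category `X'`) over the base `D'`:
"If `D` admits a pseudo-terminal object, then `F` admits a pseudo-terminal object" ([FrdI] §0).
[cite: MochizukiFrdII2008, Thm 3.6 (vi) p.37] -/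
def Thm36vi (D' : Type u₂) [Category.{v₂} D'] (X' : Type u₃) [Category.{v₃} X'] : Prop :=
  (∃ B : D', IsPseudoTerminal B) → ∃ A : X', IsPseudoTerminal A

/-! ### Theorem 3.6 (vii): isometric pre-steps and connected open subsets of `∂A_A` -/

/-- **Theorem 3.6 (vii)** (FrdII pp. 37–38), for `Λ = ℤ`, `F ∈ {C, A}` and a complex `A ∈ Ob(F)`:
"the assignment that maps an isometric pre-step `B → A` of `F` to the image of the boundary `∂A_B`
of the angular region `A_B` of `B` in the boundary `∂A_A` of the angular region `A_A` of `A`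
determines an equivalence of categories `F^imtr-pre_A ⥲ Open⁰(∂A_A)`" (`Open⁰` = connected open
subsets, [FrdII] App.; `TopRep.Open0`). Parameters: for each object `A` the space `V A` carrying
its angular region (`V_A^×`, [FrdII] Def. 3.1 (iii)) with the boundary `bd A = ∂A_A ⊆ V A`, and the maps
`vMap φ : V B → V A` underlying arrows `φ : B → A` (data (c) of Ex. 3.3 (i)); the equivalence sends an
isometric pre-step `B → A` to the (connected, open) subset of `∂A_A` with image `vMap φ (∂A_B)`. The
clause "which is functorial in `A` [cf. [FrdI] Prop. 1.9 (ii), (iii)]" refers to the functors `φ_*`,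
`φ^*` of that Proposition (seat abc-iut-L1-t1) and is not typed separately here.
[cite: MochizukiFrdII2008, Thm 3.6 (vii) p.37] -/
def Thm36vii_equiv (V : X → Type u₃) [∀ A, TopologicalSpace (V A)] (bd : ∀ A : X, Set (V A))
    (vMap : ∀ ⦃B A : X⦄, (B ⟶ A) → V B → V A) : Prop :=
  Λ = .Z → ∀ A : X, RC.complexObjects (PreFrobenioid.baseFunctor F ⋙ G) A →
    ∃ e : ImtrPreOver F A ≌ TopRep.Open0 (bd A),
      ∀ f : ImtrPreOver F A,
        Subtype.val '' ((e.functor.obj f).obj : Set (bd A)) = vMap f.obj.hom '' bd f.obj.left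

/-- **Theorem 3.6 (vii)**, "In particular, [cf. Theorem A.2, (vi)] the topological space `∂A_A` may be
recovered functorially from the category `F^imtr-pre_A`" (FrdII p. 38): typed as the hypotheses under
which [FrdII] Thm. A.2 (vi) (`TopRep.ItemVI`) recovers a space from `Open⁰(−)` — `∂A_A` is sober and
locally connected ("since `S¹` is clearly sober and locally connected", proof p. 39).
[cite: MochizukiFrdII2008, Thm 3.6 (vii) p.38] -/
def Thm36vii_recover (V : X → Type u₃) [∀ A, TopologicalSpace (V A)] (bd : ∀ A : X, Set (V A)) :
    Prop :=
  Λ = .Z → ∀ A : X, RC.complexObjects (PreFrobenioid.baseFunctor F ⋙ G) A →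
    TopRep.IsSober (bd A) ∧ LocallyConnectedSpace (bd A)

/-- **Theorem 3.6 (vii)**, last sentence (FrdII p. 38): "if `A` is isotropic, then the action of `O^×(A)`
on `∂A_A` determines on `∂A_A` a structure of torsor over this group" — the action (through `vMap`
of the underlying automorphisms) is simply transitive on `∂A_A`. [cite: MochizukiFrdII2008, Thm 3.6 (vii) p.38] -/
def Thm36vii_torsor (V : X → Type u₃) (bd : ∀ A : X, Set (V A))
    (vMap : ∀ ⦃B A : X⦄, (B ⟶ A) → V B → V A) : Prop :=
  Λ = .Z → ∀ A : X, RC.complexObjects (PreFrobenioid.baseFunctor F ⋙ G) A →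
    PreFrobenioid.IsIsotropic F A →
      ∀ x ∈ bd A, ∀ y ∈ bd A, ∃! u : PreFrobenioid.unitsSubgroup F A, vMap (u : Aut A).hom x = y

/-! ### Theorem 3.6 (viii)–(x) -/

/-- **Theorem 3.6 (viii)** (FrdII p. 38), for `F ∈ {C^Λ, A}`: "If `Λ = ℤ`, then `F[ℂ]` is of weakly
dissectible type [cf. §0]" (`F[ℂ]` = the full subcategory of complex objects, [FrdII] Def. 3.1 (v)).
[cite: MochizukiFrdII2008, Thm 3.6 (viii) p.38] -/
def Thm36viii : Prop :=
  Λ = .Z → IsOfWeaklyDissectibleType (RC.ComplexPart (PreFrobenioid.baseFunctor F ⋙ G))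

/-- **Theorem 3.6 (ix)** (FrdII p. 38), for `F ∈ {C^Λ, A}` over `G : D → D₀`: "Suppose that `D` is of
strongly indissectible type. If `D` is not complexifiable, then we assume further that `Λ ≠ ℤ`. Then
`F^istr` is of strongly indissectible type." [cite: MochizukiFrdII2008, Thm 3.6 (ix) p.38] -/
def Thm36ix : Prop :=
  IsOfStronglyIndissectibleType D → (¬ RC.IsComplexifiable G → Λ ≠ .Z) →
    IsOfStronglyIndissectibleType (PreFrobenioid.isotropicObjects F).FullSubcategory

/-- **Theorem 3.6 (x)** (FrdII p. 38), for `F ∈ {C^Λ, A}` (underlying category `X'`) over the base `D'`: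
"If `D` is slim, and `Λ ∈ {ℤ, ℝ}`, then `F` is also slim" ([FrdI] §0). [cite: MochizukiFrdII2008, Thm 3.6 (x) p.38] -/
def Thm36x (D' : Type u₂) [Category.{v₂} D'] (X' : Type u₃) [Category.{v₃} X'] : Prop :=
  IsSlim D' → Λ ≠ .Q → IsSlim X'

/-! ### Remark 3.6.1 -/

/-- **Remark 3.6.1** (FrdII p. 39): "the topology of `O^×(A)` (`≅ S¹`), for complex isotropic
`A ∈ Ob(C)`, may be recovered from the category-theoretic structure of `C` [cf. Theorem 3.6, (vii)]
precisely because of the existence of the non-isotropic objects" — typed as: transporting the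
topology of `∂A_A` (recovered from `C^imtr-pre_A` by (vii)) along the torsor bijection
`O^×(A) → ∂A_A`, `u ↦ u · x₀`, makes `O^×(A)` a copy of the topological group `S¹`: there is a group
isomorphism `O^×(A) ≅ S¹` under which every orbit map is a homeomorphism `S¹ → ∂A_A`. (The
explanatory clause "This is the principal reason for the inclusion of non-isotropic objects in the
theory of Frobenioids" is prose.) [cite: MochizukiFrdII2008, Rmk 3.6.1 p.39] -/
def Rmk361 (V : X → Type u₃) [∀ A, TopologicalSpace (V A)] (bd : ∀ A : X, Set (V A))
    (vMap : ∀ ⦃B A : X⦄, (B ⟶ A) → V B → V A) : Prop :=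
  Λ = .Z → ∀ A : X, RC.complexObjects (PreFrobenioid.baseFunctor F ⋙ G) A →
    PreFrobenioid.IsIsotropic F A → ∀ x₀ ∈ bd A,
      ∃ e : PreFrobenioid.unitsSubgroup F A ≃* Circle,
        Topology.IsEmbedding
            (fun z : Circle => vMap ((e.symm z : PreFrobenioid.unitsSubgroup F A) : Aut A).hom x₀) ∧
          Set.range (fun z : Circle => vMap ((e.symm z : PreFrobenioid.unitsSubgroup F A) : Aut A).hom x₀) =
            bd A

end ArchFrd

end Literature.AlgebraicGeometry.Frobenioids
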